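import Summits.QuantumFields.YangMills.Theorems.BalabanUVNodesN15KingModelGraphPowerCountingLogSubgraphs

/-!
# BalabanUVNodes ∕ N15 — THE KING-MODEL RUNG (PART Δ-g): **DIMENSION MONOTONICITY OF KING's POWER COUNTING** — a non-empty CONNECTED line set spans at most
# `|S| + 1` vertices (its loop number `|S| − |V(S)| + 1` is `≥ 0`), so the degree `D(S) = 2(|V(S)| − 1) − (dV − 2)·loops(S) − #∂G(S)` FALLS with the dimension
# `dV`, and King's subgraph condition in dimension `dV′` implies it in every dimension `dV ≤ dV′` (the model is «more superrenormalisable» downward: whatever needs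
# no renormalisation in `d + 1 = 4` needs none in King's `3` and `2`)
# (Track A, DAG node N15 = NE2; FAN-OUT v1.1 §N15 s3 «KING-MODEL RUNG … NE2's analogue DECIDED in the model»)

HONEST FRAMING.  Count-neutral (cell `pub-ymgap`, seat `pub-ymgap-dag-n15-e` g28; `--supports stmt-QuantumFields-27366 --as helper` = K3⁸
`SpineGivenEndpointR13SepCoPHV`).  TEMPLATE LITERATURE: C. King, *The U(1) Higgs model. I. The continuum limit*, Commun. Math. Phys. **102** (1986) 649–677
[King1986], §3.4 p. 664 and Prop. 3.7 (3.63) p. 663 (the exponents `2 − d`, `1 − d`); p. 649 («in two and three dimensions»).  Part Δ-c typed the cyclomatic form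
`subDeg_lineExp_eq` with `loopNumber S := |S| − |V(S)| + 1 : ℤ` but did not prove it non-negative; part Δ-f built `prefixPerm S` (an ordering listing `S` first,
after `|S|` steps `S` is ONE Kruskal point).  THIS FILE: Γ-k's count «tree lines + points = vertices» on that ordering gives `|V(S)| − 1` tree lines inside `S`,
hence `|V(S)| ≤ |S| + 1` for connected `S`; then the degree is anti-monotone in the dimension and both subgraph conditions (`PosSubgraphsBy`, `NonnegSubgraphs`)
descend to lower dimensions.  Finite combinatorics; King's U(1)∕`A = 0` model bookkeeping; NOT Bałaban's `G(U)`; NOT a node discharge; nothing continuum ∕ ℝ⁴ ∕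
OS ∕ mass-gap ∕ Clay.  0 `sorry`; standard axioms.
THE PRINT.  p. 663 [PDF 15], (3.63): *«|G^η_{(j)}(x, y)| ≤ C(L^jη)^{2−d} …, |∂^η_μ G^η_{(j)}(x, y)| ≤ C(L^jη)^{1−d} …»*; p. 664 [PDF 16]: *«it is necessary that every subgraph
have positive degree D»*.
WHAT THIS FILE PROVES.
* §1 (ns `…Graph`) ★ `card_image_klab_eq_one_of_connected` (a connected non-empty `S` listed first is ONE point after `|S|` steps), ★★ **`card_lineVerts_le_card_succ_of_connected`**
  (`|V(S)| ≤ |S| + 1` for non-empty connected `S`), ★ **`loopNumber_nonneg_of_connected`** (`0 ≤ loopNumber src tgt S`).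
* §2 (ns `…Curved`) `dLines_eq_of_isSome_eq`, ★★ **`subDeg_lineExp_anti_dim`** (`dd ≤ dd′`, same `∂`-pattern ⇒ `D_{dd′}(S) ≤ D_{dd}(S)` for connected non-empty `S`),
  ★★ **`posSubgraphsBy_lineExp_of_dim_le`** (the subgraph condition descends from `dd′` to `dd ≤ dd′`, any margin), ★ `nonnegSubgraphs_lineExp_of_dim_le`,
  ★ `posSubgraphsBy_GLines_of_dim_le` (`G`-lines only).
HONEST SCOPE.  Bookkeeping of King's exponent table only; King's dimensions are `d = 2, 3`; nothing about which graphs occur.  Locators: [King1986] (3.63) p.663, p.664.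
-/
noncomputable section

namespace Summit.QuantumFields.YangMills.BalabanUVNodes.N15KingModelRung.Graph

open scoped BigOperators
open Finset
open Summit.QuantumFields.YangMills.BalabanUVNodes.N15KingModelRung.Curved (loopNumber)

/-! ## §1 A connected line set spans at most `|S| + 1` vertices -/

section Connected
variable {nn m : ℕ} {src tgt : Fin m → Fin (nn + 1)}

/-- ★ **A CONNECTED NON-EMPTY LINE SET, LISTED FIRST, IS ONE POINT AFTER `|S|` STEPS**: the label image of `V(S)` under `klab (prefixPerm S) |S|` is a singleton.
[cite: King1986, p.664 («eventually shrinking H to one point»)] -/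
theorem card_image_klab_eq_one_of_connected {S : Finset (Fin m)} (hS : S.Nonempty)
    (hc : ∀ u ∈ lineVerts src tgt S, ∀ v ∈ lineVerts src tgt S, LConn src tgt S u v) :
    ((lineVerts src tgt (prefixLines (prefixPerm S) S.card)).image (klab src tgt (prefixPerm S) S.card)).card = 1 := by
  classical
  have hπ : prefixLines (prefixPerm S) S.card = S := prefixLines_prefixPerm S
  obtain ⟨ℓ₀, hℓ₀⟩ := hS
  have hlab : ∀ v ∈ lineVerts src tgt S, klab src tgt (prefixPerm S) S.card v = klab src tgt (prefixPerm S) S.card (src ℓ₀) := by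
    intro v hv
    have h := hc v hv (src ℓ₀) (src_mem_lineVerts hℓ₀)
    rw [← hπ] at h
    exact klab_eq_of_lConn_prefixLines h
  rw [hπ, card_eq_one]
  refine ⟨klab src tgt (prefixPerm S) S.card (src ℓ₀), ?_⟩
  ext c
  simp only [mem_image, mem_singleton]
  constructor
  · rintro ⟨v, hv, rfl⟩; exact hlab v hv
  · rintro rfl; exact ⟨src ℓ₀, src_mem_lineVerts hℓ₀, rfl⟩

/-- ★★ **A NON-EMPTY CONNECTED LINE SET SPANS AT MOST `|S| + 1` VERTICES**: listing `S` first, after `|S|` steps Kruskal has used `|V(S)| − 1` tree lines (part Γ-k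
«tree lines + points = vertices», one point), all of them lines of `S`. [cite: King1986, p.664] -/
theorem card_lineVerts_le_card_succ_of_connected {S : Finset (Fin m)} (hS : S.Nonempty)
    (hc : ∀ u ∈ lineVerts src tgt S, ∀ v ∈ lineVerts src tgt S, LConn src tgt S u v) :
    (lineVerts src tgt S).card ≤ S.card + 1 := by
  classical
  have hπ : prefixLines (prefixPerm S) S.card = S := prefixLines_prefixPerm S
  have hcount := card_kruskalTreeUpTo_add (src := src) (tgt := tgt) (prefixPerm S) S.card
  rw [card_image_klab_eq_one_of_connected hS hc, hπ] at hcount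
  have htree : (kruskalTreeUpTo src tgt (prefixPerm S) S.card).card ≤ S.card :=
    calc (kruskalTreeUpTo src tgt (prefixPerm S) S.card).card ≤ (prefixLines (prefixPerm S) S.card).card :=
          card_le_card kruskalTreeUpTo_subset_prefixLines
      _ = S.card := by rw [hπ]
  omega

/-- ★ **THE LOOP NUMBER OF A NON-EMPTY CONNECTED LINE SET IS NON-NEGATIVE** (`|S| − |V(S)| + 1 ≥ 0`, part Δ-c's `loopNumber`). [folklore] -/
theorem loopNumber_nonneg_of_connected {S : Finset (Fin m)} (hS : S.Nonempty)
    (hc : ∀ u ∈ lineVerts src tgt S, ∀ v ∈ lineVerts src tgt S, LConn src tgt S u v) : 0 ≤ loopNumber src tgt S := by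
  have h := card_lineVerts_le_card_succ_of_connected hS hc
  unfold loopNumber
  omega

end Connected

end Summit.QuantumFields.YangMills.BalabanUVNodes.N15KingModelRung.Graph

namespace Summit.QuantumFields.YangMills.BalabanUVNodes.N15KingModelRung.Curved

open scoped BigOperators
open Finset
open Summit.QuantumFields.YangMills.BalabanUVNodes.N15KingModelRung.Graph

variable (L : ℕ)

/-! ## §2 The degree falls with the dimension; the subgraph conditions descend -/

section Dimension
variable {nn m : ℕ} {src tgt : Fin m → Fin (nn + 1)}

omit L in
/-- the number of `∂G`-lines depends only on the `∂`-pattern. [cite: King1986, (3.63) p.663] -/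
theorem dLines_eq_of_isSome_eq {dd dd' : ℕ} {κ₁ : Fin m → Option (Fin dd)} {κ₂ : Fin m → Option (Fin dd')}
    (h : ∀ ℓ, (κ₁ ℓ).isSome = (κ₂ ℓ).isSome) (S : Finset (Fin m)) : dLines κ₁ S = dLines κ₂ S := by
  unfold dLines
  rw [filter_congr fun ℓ _ => by rw [h ℓ]]

omit L in
/-- ★★ **KING's DEGREE IS ANTI-MONOTONE IN THE DIMENSION**: for `dd ≤ dd′`, the same graph with the same `∂`-pattern has `D_{dd′}(S) ≤ D_{dd}(S)` for every
non-empty connected `S` — by part Δ-c `D(S) = 2(|V(S)| − 1) − (dV − 2)·loops(S) − #∂G(S)` and §1 `loops(S) ≥ 0`. [cite: King1986, (3.63) p.663, p.664] -/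
theorem subDeg_lineExp_anti_dim {dd dd' : ℕ} (hdd : dd ≤ dd') {κ₁ : Fin m → Option (Fin dd)} {κ₂ : Fin m → Option (Fin dd')}
    (hκ : ∀ ℓ, (κ₁ ℓ).isSome = (κ₂ ℓ).isSome) {S : Finset (Fin m)} (hS : S.Nonempty)
    (hc : ∀ u ∈ lineVerts src tgt S, ∀ v ∈ lineVerts src tgt S, LConn src tgt S u v) :
    subDeg src tgt ((dd' : ℕ) : ℝ) (fun ℓ => lineExp dd' (κ₂ ℓ)) S ≤ subDeg src tgt ((dd : ℕ) : ℝ) (fun ℓ => lineExp dd (κ₁ ℓ)) S := by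
  rw [subDeg_lineExp_eq, subDeg_lineExp_eq, dLines_eq_of_isSome_eq hκ]
  have hl : (0 : ℝ) ≤ (loopNumber src tgt S : ℝ) := by exact_mod_cast loopNumber_nonneg_of_connected hS hc
  have hdd' : ((dd : ℕ) : ℝ) ≤ ((dd' : ℕ) : ℝ) := by exact_mod_cast hdd
  nlinarith [mul_le_mul_of_nonneg_right hdd' hl]

omit L in
/-- ★★ **KING's SUBGRAPH CONDITION DESCENDS TO LOWER DIMENSIONS**: if it holds (margin `γ₁`) in dimension `dd′` then it holds in every `dd ≤ dd′` for the same graph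
and `∂`-pattern — the model is more superrenormalisable downward. [cite: King1986, p.664, p.649 («in two and three dimensions»)] -/
theorem posSubgraphsBy_lineExp_of_dim_le {dd dd' : ℕ} (hdd : dd ≤ dd') {κ₁ : Fin m → Option (Fin dd)} {κ₂ : Fin m → Option (Fin dd')}
    (hκ : ∀ ℓ, (κ₁ ℓ).isSome = (κ₂ ℓ).isSome) {γ₁ : ℝ} (h : PosSubgraphsBy src tgt γ₁ ((dd' : ℕ) : ℝ) (fun ℓ => lineExp dd' (κ₂ ℓ))) :
    PosSubgraphsBy src tgt γ₁ ((dd : ℕ) : ℝ) (fun ℓ => lineExp dd (κ₁ ℓ)) :=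
  fun S hS hc => lt_of_lt_of_le (h S hS hc) (subDeg_lineExp_anti_dim hdd hκ hS hc)

omit L in
/-- ★ **THE NON-NEGATIVE CONDITION DESCENDS LIKEWISE.** [cite: King1986, p.664] -/
theorem nonnegSubgraphs_lineExp_of_dim_le {dd dd' : ℕ} (hdd : dd ≤ dd') {κ₁ : Fin m → Option (Fin dd)} {κ₂ : Fin m → Option (Fin dd')}
    (hκ : ∀ ℓ, (κ₁ ℓ).isSome = (κ₂ ℓ).isSome) (h : NonnegSubgraphs src tgt ((dd' : ℕ) : ℝ) (fun ℓ => lineExp dd' (κ₂ ℓ))) :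
    NonnegSubgraphs src tgt ((dd : ℕ) : ℝ) (fun ℓ => lineExp dd (κ₁ ℓ)) :=
  fun S hS hc => (h S hS hc).trans (subDeg_lineExp_anti_dim hdd hκ hS hc)

omit L in
/-- ★ **FOR `G`-LINES ONLY**: the condition in dimension `dd′` gives it in every `dd ≤ dd′`. [cite: King1986, p.664] -/
theorem posSubgraphsBy_GLines_of_dim_le {dd dd' : ℕ} (hdd : dd ≤ dd') {γ₁ : ℝ}
    (h : PosSubgraphsBy src tgt γ₁ ((dd' : ℕ) : ℝ) (fun ℓ => lineExp dd' ((fun _ : Fin m => (none : Option (Fin dd'))) ℓ))) :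
    PosSubgraphsBy src tgt γ₁ ((dd : ℕ) : ℝ) (fun ℓ => lineExp dd ((fun _ : Fin m => (none : Option (Fin dd))) ℓ)) :=
  posSubgraphsBy_lineExp_of_dim_le hdd (fun _ => rfl) h

end Dimension

end Summit.QuantumFields.YangMills.BalabanUVNodes.N15KingModelRung.Curved

end
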